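import Summits.BirchSwinnertonDyer.BirchSwinnertonDyer.Theorems.PrintX8MazurTateThreeCollapse
import HarnessLib

/-!
# Route `PrintX8`, crux `MuBoundSmallImageX8` (stmt-BirchSwinnertonDyer-20622), LINE «vertical Stevens at 3»,
# part 2: the support VS-G as a kernel theorem — a cyclotomic winding symbol that is non-constant modulo `3`
# gives ONE colour `• ∈ {♯, ♭}` with `L^•_3(E) ≢ 0 (mod 3)`, per pair and class-wide
# (cell `bsd-print-x8`, D-0131 (2) print tier, prover seat p3 g3; `--supports` 20622, closes nothing)

PARTITION (cell bsd-print-x8, leaf `ClassX8` = `3` good supersingular with `a_3 = ±3`): this is the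
support «VS-G» `GlueOneColourOfCycWindingX8 : CycWindingNonConstantSmallImageX8 → OneColourMuAnSmallImageX8`
of the planner's LINE «vertical Stevens at 3» (`run/shared/lean/pub/bsd-print-x8/plan/vs/` memo §2,
`SketchVS.lean` §2; plan g4, evidence #16–#21 on item 20622) PROVED, with both sides inlined verbatim (no
definition is introduced; the carriers are the T-VS typing ask).  Closes NO item, moves 0 census cells; the
Birch–Swinnerton-Dyer formula is not proved by any of this.  beyond-print: yes (modest).

## The statement (per pair; `ClassX8.exists_red_chromaticL_ne_zero_of_one_le_norm_sub`)

Let `E = W` be in class X8 (`p = 3`, good supersingular, `a_3 = ±3`; ANY `3`-adic image, any rank),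
`f` its newform, `(L♯, L♭)` ANY Sprung pair (`IsSprungPair`).  If for some `n` and integers `a, a'`
`‖[a/3ⁿ]⁺_f − [a'/3ⁿ]⁺_f‖₃ ≥ 1` — the winding function `x ↦ [x]⁺_f` is NOT constant modulo `3` on
`ℤ[1/3]`: statement VS-1 `CycWindingNonConstantSmallImageX8` at the pair — then some colour `•` has
`red L^• ≠ 0`, hence `L^• ≠ 0`, `μ(L^•) = 0`, unit content and `μ(Λ/(L^•)) = 0`
(`ClassX8.exists_chromaticL_muZero_of_one_le_norm_sub`).  Class-wide (§6):
`oneColourMuAn_of_cycWindingNonConstantSmallImageX8 : VS-1 → OneColourMuAnSmallImageX8`, VS-1 in the item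
spelling of `plan/vs/resplit-VS-children.json` child 1 and the conclusion = the binder `hμ1` of p548147's
`PrintX8SharpFlatMuTransfer.muBoundSmallImageX8_of_oneColour_sharpFlatMuAn`, both VERBATIM — so that
`muBoundSmallImageX8_of_oneColour_sharpFlatMuAn hCK h3 (oneColourMuAn_of_cycWindingNonConstantSmallImageX8 hVS)
: Theses.PrintX8.MuBoundSmallImageX8` (recorded in `PrintX8VerticalStevens.lean`); and the image-free form
`oneColourMuAn_of_cycWindingNonConstantX8` (VS-1⁺ on all of X8 ⟹ one colour, all four currencies).

## The proof (part 1 = `PrintX8MazurTateThreeCollapse.lean` supplies §1–§4)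

§5 Per pair: both symbols are `3`-integral (`a_3 ≢ 1 (mod 3)`, Sprung 2017 Cor. 4.10), their difference
has norm `≥ 1`, so one of them is a `3`-adic unit; by `ratPlusSymbol_intCast_div_pow_cases` it is `[0]⁺_f`
— then BOTH colours are units of `Λ` (`ClassX8.isUnit_chromaticL`, Kurihara's pattern) — or `[c/3^{m+1}]⁺_f`
with `3 ∤ c` — then `red Θ_m ≠ 0` by the collapse lemma, whence `red L♭ ≠ 0` (`m` even) / `red L♯ ≠ 0`
(`m` odd) by p3 g1's readings `red_flat_ne_zero_of_mazurTate_even` / `red_sharp_ne_zero_of_mazurTate_odd`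
(Sprung 2017 Thm. 1.12 / Cor. 4.4 integrally, `ω_m ≡ T^{3ᵐ}`, `v_m ≡ 0` resp. `u_m ≡ 0`).  §6 class-wide.
What it does NOT give: both colours (item 20714 An) — the winding symbol sees one layer of unknown parity.
No rank and no image hypothesis is used (`¬ Surj`, `r_an ≤ 1` are carried vacuously, as in VS-G).

References: [Pollack2003] Def. 6.15, Prop. 6.9–6.10; [Sprung2017] §3.1, Cor. 4.4, Cor. 4.10, Thm. 1.12;
[MazurTateTeitelbaum1986Invent] §I.4 (4.2), §I.8; [Kurihara2002] Thm. 0.1; [PerrinRiou2003] §6.1 Conj. 6.1.1;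
[GreenbergVatsal2000] p. 2 (1)–(2); planner memo LINE-VERTICAL-STEVENS-AT-3.md §2 (plan g4); files
`Theorems/PrintX8MazurTateMuRider.lean` (p546221), `Rank1Residual/Supersingular/MazurTateConstantTermsMu.lean`,
`Theorems/PrintX8SharpFlatMuBoundGlue.lean` (p548147).
-/

set_option autoImplicit false
-- justification: the mandated namespace `Summit.BirchSwinnertonDyer.BirchSwinnertonDyer.Theorems`
-- (single-conjunct summit, Sub = Summit) repeats a segment by design (D-0017).
set_option linter.dupNamespace false

noncomputable section

open scoped Classical MatrixGroups ModularForm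

open CongruenceSubgroup Polynomial WeierstrassCurve Literature.NumberTheory.EllipticCurves
  Literature.NumberTheory.EllipticCurves.ModularForms
  Literature.NumberTheory.EllipticCurves.Sprung2017
  Literature.NumberTheory.EllipticCurves.Rank1Residual
  Literature.NumberTheory.EllipticCurves.GreenbergVatsal2000
  Summit.BirchSwinnertonDyer.Rank1Residual.X1.MuLambda
  Summit.BirchSwinnertonDyer.Rank1Residual.Supersingular
  Summit.BirchSwinnertonDyer.BirchSwinnertonDyer.Theorems.PrintX8MazurTateMuRider
  Summit.BirchSwinnertonDyer.BirchSwinnertonDyer.Theorems.PrintX8MazurTateThreeCollapse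

namespace Summit.BirchSwinnertonDyer.BirchSwinnertonDyer.Theorems.PrintX8VerticalStevensCollapse

/-! ### §5. Class X8, per pair: a non-constant winding symbol gives ONE colour with `red L^• ≠ 0` -/

section Pair

variable {W : WeierstrassCurve ℚ} [W.IsElliptic] [W.IsGloballyMinimal] {N : ℕ} [NeZero N]
  {f : CuspForm (Gamma0 N) 2} {p : ℕ} [hp : Fact p.Prime]

/-- **Class X8, per pair (`p = 3`, good supersingular, `a_3 = ±3`; ANY image, any rank): if
`‖[a/3ⁿ]⁺_f − [a'/3ⁿ]⁺_f‖₃ ≥ 1` for some `n ∈ ℕ`, `a, a' ∈ ℤ` — VS-1 at the pair — then some colour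
`• ∈ {♯, ♭}` has `red L^• ≠ 0`**, for `f` the newform and ANY Sprung pair `(L♯, L♭)`.
Both symbols are `3`-integral (`a_3 ≢ 1 (mod 3)`), so one of them is a `3`-adic unit; it is `[0]⁺_f`
(⟹ both colours are units of `Λ`, `ClassX8.isUnit_chromaticL`) or `[c/3^{m+1}]⁺_f` with `3 ∤ c`
(⟹ `red Θ_m ≠ 0` by the collapse ⟹ `red L♭ ≠ 0` for even `m`, `red L♯ ≠ 0` for odd `m`, by
`red_flat_ne_zero_of_mazurTate_even` / `red_sharp_ne_zero_of_mazurTate_odd`).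
[cite: Pollack2003, Def. 6.15, Prop. 6.9 and Prop. 6.10] [cite: Sprung2017, §3.1, Cor. 4.4, Cor. 4.10 and Thm. 1.12]
[cite: Kurihara2002, Thm. 0.1] -/
theorem ClassX8.exists_red_chromaticL_ne_zero_of_one_le_norm_sub (hX : ClassX8 W p)
    (hf : IsNewformOf W f) {Lsharp Lflat : IwasawaAlgebra p}
    (hSP : IsSprungPair f p (W.frobeniusTrace p) Lsharp Lflat) {n : ℕ} {a a' : ℤ}
    (hVS : 1 ≤ ‖((ratPlusSymbol f ((a : ℚ) / (p : ℚ) ^ n) -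
      ratPlusSymbol f ((a' : ℚ) / (p : ℚ) ^ n) : ℚ) : ℚ_[p])‖) :
    ∃ c : Chroma, red (chromaticL c Lsharp Lflat) ≠ 0 := by
  obtain ⟨hp3, hss, ha3⟩ := hX
  subst hp3
  have hp2 : (3 : ℕ) ≠ 2 := by decide
  have hgood : W.HasGoodReductionAtPrime 3 := hss.1
  have hap3 : ((3 : ℕ) : ℤ) ∣ W.frobeniusTrace 3 := hss.2
  have hf0 : IsNewform0 f := hf.1
  have hpN : ¬ 3 ∣ N := not_dvd_level_of_isNewformOf hf hgood
  have hap : cuspCoeff f 3 = ((W.frobeniusTrace 3 : ℤ) : ℂ) :=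
    cuspCoeff_eq_frobeniusTrace_of_isNewformOf_holds hf hgood
  have hpa : ¬ ((3 : ℕ) : ℤ) ∣ W.frobeniusTrace 3 - 1 := by
    intro h
    have h1 : ((3 : ℕ) : ℤ) ∣ W.frobeniusTrace 3 - (W.frobeniusTrace 3 - 1) := dvd_sub hap3 h
    rw [sub_sub_cancel] at h1
    norm_num at h1
  -- every symbol `[b/3ⁿ]⁺`, `b ∈ ℤ`, is `3`-integral
  have hint : ∀ b : ℤ, ‖((ratPlusSymbol f ((b : ℚ) / ((3 : ℕ) : ℚ) ^ n) : ℚ) : ℚ_[3])‖ ≤ 1 := by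
    intro b
    rcases ratPlusSymbol_intCast_div_pow_cases f 3 n b with h | ⟨m, c, -, h⟩
    · rw [h]
      have h0 := norm_ratPlusSymbol_div_pow_le_one_of_not_dvd hp2 hf0 hpN hap hpa 0 0
      simpa using h0
    · rw [h]
      exact norm_ratPlusSymbol_div_pow_le_one_of_not_dvd hp2 hf0 hpN hap hpa c (m + 1)
  -- a symbol of norm exactly `1` gives a colour
  have key : ∀ b : ℤ, ‖((ratPlusSymbol f ((b : ℚ) / ((3 : ℕ) : ℚ) ^ n) : ℚ) : ℚ_[3])‖ = 1 →
      ∃ c : Chroma, red (chromaticL c Lsharp Lflat) ≠ 0 := by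
    intro b hb
    rcases ratPlusSymbol_intCast_div_pow_cases f 3 n b with h | ⟨m, c, hc, h⟩
    · -- the unit case `ord₃ [0]⁺ = 0`: both colours are units of `Λ`
      rw [h] at hb
      have hr : ratPlusSymbol f 0 ≠ 0 := by
        intro h0
        rw [h0, Rat.cast_zero, norm_zero] at hb
        exact zero_ne_one hb
      have hv : padicValRat 3 (ratPlusSymbol f 0) = 0 := by
        rw [Padic.eq_padicNorm, padicNorm.eq_zpow_of_nonzero hr] at hb
        have hb' : ((3 : ℚ) ^ (-padicValRat 3 (ratPlusSymbol f 0)) : ℚ) = 1 := by exact_mod_cast hb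
        have h3 := (zpow_eq_one_iff_right₀ (by norm_num : (0 : ℚ) ≤ 3) (by norm_num : (3 : ℚ) ≠ 1)).mp hb'
        omega
      have hU : IsUnit (chromaticL Chroma.sharp Lsharp Lflat) :=
        ClassX8.isUnit_chromaticL ⟨rfl, hss, ha3⟩ hf hSP Chroma.sharp hr hv
      exact ⟨Chroma.sharp, (hU.map (PowerSeries.map (IsLocalRing.residue ℤ_[3]))).ne_zero⟩
    · -- a unit symbol at level `3^{m+1}`: the collapse at layer `m`
      rw [h] at hb
      obtain ⟨Q, hQ⟩ := exists_integral_mazurTate_of_isSprungPair hp2 hf hgood hap3 hSP m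
      have he : cyclotomicExponent 3 = 1 := if_neg hp2
      have hred : red (toIwasawa 3 (cyclotomicOmega 3 m) * Q -
          (toIwasawa 3 (sharpPoly (W.frobeniusTrace 3) 3 m) * Lsharp +
            toIwasawa 3 (flatPoly (W.frobeniusTrace 3) 3 m) * Lflat)) ≠ 0 :=
        red_ne_zero_of_mazurTate_of_norm_ratPlusSymbol_eq_one f rfl hf0 hpN hap hpa hQ.symm hc
          (by rw [he]; exact hb)
      have hΘ0 := ne_zero_of_red_ne_zero hred
      have hμ := (mu_eq_zero_and_lam_eq_of_red_ne_zero hred).1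
      rcases Nat.even_or_odd m with hm | hm
      · exact ⟨Chroma.flat,
          red_flat_ne_zero_of_mazurTate_even hp2 hf hgood hap3 hSP hm hQ.symm hΘ0 hμ⟩
      · exact ⟨Chroma.sharp,
          red_sharp_ne_zero_of_mazurTate_odd hp2 hf hgood hap3 hSP hm hQ.symm hΘ0 hμ⟩
  -- one of the two symbols is a unit (both integral, difference of norm `≥ 1`)
  rw [Rat.cast_sub] at hVS
  have hmax := Padic.nonarchimedean
    ((ratPlusSymbol f ((a : ℚ) / ((3 : ℕ) : ℚ) ^ n) : ℚ) : ℚ_[3])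
    (-((ratPlusSymbol f ((a' : ℚ) / ((3 : ℕ) : ℚ) ^ n) : ℚ) : ℚ_[3]))
  rw [norm_neg, ← sub_eq_add_neg] at hmax
  rcases le_max_iff.mp (hVS.trans hmax) with h | h
  · exact key a (le_antisymm (hint a) h)
  · exact key a' (le_antisymm (hint a') h)

/-- **Class X8, per pair: VS-1 at the pair ⟹ ONE colour `•` with `L^• ≠ 0`, `μ(L^•) = 0`
(power-series `μ`), UNIT CONTENT, and `μ(Λ/(L^•)) = 0` (module `μ`)** — the one-colour analytic rider of
crux 20622 in all its currencies, from a non-constant cyclotomic winding symbol; ANY image, any rank, `f`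
the newform, ANY Sprung pair.  [cite: Pollack2003, Def. 6.15, Prop. 6.9 and Prop. 6.10]
[cite: Sprung2017, §3.1, Cor. 4.4, Cor. 4.10 and Thm. 1.12] [cite: GreenbergVatsal2000, p. 2, (1)–(2)] -/
theorem ClassX8.exists_chromaticL_muZero_of_one_le_norm_sub (hX : ClassX8 W p)
    (hf : IsNewformOf W f) {Lsharp Lflat : IwasawaAlgebra p}
    (hSP : IsSprungPair f p (W.frobeniusTrace p) Lsharp Lflat) {n : ℕ} {a a' : ℤ}
    (hVS : 1 ≤ ‖((ratPlusSymbol f ((a : ℚ) / (p : ℚ) ^ n) -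
      ratPlusSymbol f ((a' : ℚ) / (p : ℚ) ^ n) : ℚ) : ℚ_[p])‖) :
    ∃ c : Chroma, chromaticL c Lsharp Lflat ≠ 0 ∧ mu (chromaticL c Lsharp Lflat) = 0 ∧
      HasUnitContent (chromaticL c Lsharp Lflat) ∧
      muInvariant p (IwasawaAlgebra p ⧸ Ideal.span {chromaticL c Lsharp Lflat}) = 0 := by
  obtain ⟨c, hc⟩ := ClassX8.exists_red_chromaticL_ne_zero_of_one_le_norm_sub hX hf hSP hVS
  exact ⟨c, ne_zero_of_red_ne_zero hc, (mu_eq_zero_and_lam_eq_of_red_ne_zero hc).1,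
    hasUnitContent_of_red_ne_zero hc, muInvariant_quotient_span_eq_zero_of_red_ne_zero hc⟩

/-- **Class X8, per pair, winding form ⟹ unit content** (the shape P-VS (a) of the planner's ask:
`CycWindingNonConstantAt W 3` at the newform ⟹ `∃ •, HasUnitContent (L^•)`). [cite: Pollack2003, Def. 6.15]
[cite: Sprung2017, Cor. 4.10 and Thm. 1.12] -/
theorem ClassX8.exists_hasUnitContent_chromaticL_of_cycWindingNonConstant (hX : ClassX8 W p)
    (hf : IsNewformOf W f) {Lsharp Lflat : IwasawaAlgebra p}
    (hSP : IsSprungPair f p (W.frobeniusTrace p) Lsharp Lflat)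
    (hVS : ∃ (n : ℕ) (a a' : ℤ), 1 ≤ ‖((ratPlusSymbol f ((a : ℚ) / (p : ℚ) ^ n) -
      ratPlusSymbol f ((a' : ℚ) / (p : ℚ) ^ n) : ℚ) : ℚ_[p])‖) :
    ∃ c : Chroma, HasUnitContent (chromaticL c Lsharp Lflat) := by
  obtain ⟨n, a, a', h⟩ := hVS
  obtain ⟨c, -, -, hc, -⟩ := ClassX8.exists_chromaticL_muZero_of_one_le_norm_sub hX hf hSP h
  exact ⟨c, hc⟩

end Pair

/-! ### §6. Class-wide: VS-1 ⟹ the one-colour rider `hμ1` of p548147 (both VERBATIM) -/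

section ClassWide

/-- **VS-G `GlueOneColourOfCycWindingX8` as a theorem**: the statement VS-1
`CycWindingNonConstantSmallImageX8` of LINE «vertical Stevens at 3» (item spelling of
`plan/vs/resplit-VS-children.json` child 1, verbatim: on every X8 pair with `ρ̄_{E,3}` not onto, the
winding symbol of the newform is non-constant modulo `3` on `ℤ[1/3]`) implies the ONE-COLOUR analytic
rider `OneColourMuAnSmallImageX8` = the binder `hμ1` of
`PrintX8SharpFlatMuTransfer.muBoundSmallImageX8_of_oneColour_sharpFlatMuAn` (p548147), verbatim.  The
hypotheses `¬ Surj`, `analyticRank ≤ 1` are carried, not used. [cite: Pollack2003, Def. 6.15]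
[cite: Sprung2017, Cor. 4.10 and Thm. 1.12] [cite: PerrinRiou2003, §6.1 Conjecture 6.1.1] -/
theorem oneColourMuAn_of_cycWindingNonConstantSmallImageX8
    (hVS : ∀ (W : WeierstrassCurve ℚ) [W.IsElliptic] [W.IsGloballyMinimal] (p : ℕ) [Fact p.Prime],
      ClassX8 W p → ¬ Surj W p → ∀ (N : ℕ) (_ : NeZero N) (f : CuspForm (Gamma0 N) 2),
        IsNewformOf W f → ∃ (n : ℕ) (a a' : ℤ), 1 ≤ ‖((ratPlusSymbol f ((a : ℚ) / (p : ℚ) ^ n) -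
          ratPlusSymbol f ((a' : ℚ) / (p : ℚ) ^ n) : ℚ) : ℚ_[p])‖) :
    ∀ (W : WeierstrassCurve ℚ) [W.IsElliptic] [W.IsGloballyMinimal] (p : ℕ) [Fact p.Prime],
      ClassX8 W p → ¬ Surj W p → W.analyticRank ≤ 1 →
      ∀ (N : ℕ) (_ : NeZero N) (f : CuspForm (Gamma0 N) 2) (Lsharp Lflat : IwasawaAlgebra p),
      IsNewformOf W f → IsSprungPair f p (W.frobeniusTrace p) Lsharp Lflat →
      ∃ col₀ : Chroma, HasUnitContent (chromaticL col₀ Lsharp Lflat) := by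
  intro W _ _ p _ hX hs _ N hN f Lsharp Lflat hf hSP
  haveI := hN
  exact ClassX8.exists_hasUnitContent_chromaticL_of_cycWindingNonConstant hX hf hSP
    (hVS W p hX hs N hN f hf)

/-- **The image-free form**: VS-1⁺ `CycWindingNonConstantX8` (non-constant winding symbol on ALL of X8,
no image hypothesis) ⟹ one colour with unit content on every X8 pair — the mechanism never uses
`¬ Surj`. [cite: Pollack2003, Def. 6.15] [cite: Sprung2017, Cor. 4.10 and Thm. 1.12] -/
theorem oneColourMuAn_of_cycWindingNonConstantX8
    (hVS : ∀ (W : WeierstrassCurve ℚ) [W.IsElliptic] [W.IsGloballyMinimal] (p : ℕ) [Fact p.Prime],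
      ClassX8 W p → ∀ (N : ℕ) (_ : NeZero N) (f : CuspForm (Gamma0 N) 2),
        IsNewformOf W f → ∃ (n : ℕ) (a a' : ℤ), 1 ≤ ‖((ratPlusSymbol f ((a : ℚ) / (p : ℚ) ^ n) -
          ratPlusSymbol f ((a' : ℚ) / (p : ℚ) ^ n) : ℚ) : ℚ_[p])‖) :
    ∀ (W : WeierstrassCurve ℚ) [W.IsElliptic] [W.IsGloballyMinimal] (p : ℕ) [Fact p.Prime],
      ClassX8 W p →
      ∀ (N : ℕ) (_ : NeZero N) (f : CuspForm (Gamma0 N) 2) (Lsharp Lflat : IwasawaAlgebra p),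
      IsNewformOf W f → IsSprungPair f p (W.frobeniusTrace p) Lsharp Lflat →
      ∃ col₀ : Chroma, chromaticL col₀ Lsharp Lflat ≠ 0 ∧ mu (chromaticL col₀ Lsharp Lflat) = 0 ∧
        HasUnitContent (chromaticL col₀ Lsharp Lflat) ∧
        muInvariant p (IwasawaAlgebra p ⧸ Ideal.span {chromaticL col₀ Lsharp Lflat}) = 0 := by
  intro W _ _ p _ hX N hN f Lsharp Lflat hf hSP
  haveI := hN
  obtain ⟨n, a, a', h⟩ := hVS W p hX N hN f hf
  exact ClassX8.exists_chromaticL_muZero_of_one_le_norm_sub hX hf hSP h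

end ClassWide

end Summit.BirchSwinnertonDyer.BirchSwinnertonDyer.Theorems.PrintX8VerticalStevensCollapse

end
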